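import Mathlib
import HarnessLib
import Summits.AtomisticToContinuum.FouriersLaw.Theses.CageBudgetFekete
import Summits.AtomisticToContinuum.FouriersLaw.Theorems.LatticeLandauDampingAbelThermodynamicLimitOfUniformAbelianRegularity

/-!
# glue-CageBudgetFekete-R.lean — DEMONSTRATION (crux-strategist s2 on stmt-11749, 2026-08-17): route CageBudgetFekete decides
# FouriersLaw WITHOUT `AbelThermodynamicLimit` (stmt-12596) and WITHOUT its children — in particular without `ConductanceLowerBound`
# (stmt-11749) — using instead the sibling child (R) `UniformAbelianRegularity` (stmt-13416) and the LANDED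
# `SeriesLawAtEveryLaplaceFrequency.stub_repairedCruxOfUniformAbelianRegularity` ((R) alone ⇒ the repaired Abelian thermodynamic
# limit for SHIFT-INVARIANT witnesses; the route's witness is shift-invariant by `SymmetricSetup`).

This is the route's current deciding theorem `CageBudgetFekete.closes` (rev 3) VERBATIM except for (i) the last binder
`(hTL : AbelThermodynamicLimit)` ↦ `(hR : UniformAbelianRegularity)` and (ii) the one application of `hTL`, replaced by
`stub_repairedCruxOfUniformAbelianRegularity hR` fed with the shift-invariance `hSI` that `SymmetricSetup` already provides.
Not filed (a crux-strategist does not edit `closes`); offered to the route's tenure / route-repair planner as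
`ledger route edit route-AtomisticToContinuum-CageBudgetFekete --closes-file <this file>` (then AbelThermodynamicLimit and
ConductanceLowerBound leave the cone: mark aside / drop per BC6).
-/

namespace Summit.AtomisticToContinuum.FouriersLaw.Theses.CageBudgetFekete

open scoped BigOperators Topology Manifold Classical MeasureTheory ProbabilityTheory Matrix InnerProductSpace ComplexConjugate ContinuousMap
open Filter Set Function TopologicalSpace MeasureTheory

namespace StrategistS2

theorem closes (hSet : SymmetricSetup) (hHC : HeatVarianceCalculus) (hQ : QuasiSuperadditiveHeatVariance)
    (hCeil : HeatVarianceCeiling) (hU : UnboundedHeatVariance) (hR : UniformAbelianRegularity) : FouriersLaw := by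
  intro ω₂ lam β γ hω hl hβ hγ
  have hUq := Theorems.nessUnique_proof ω₂ lam β γ hω hl hβ hγ -- crux-only glue (repair 2026-08-16)
  refine ⟨fun N T_L T_R h1 h2 => ?_, ?_⟩
  · obtain ⟨μ, hμ⟩ := Literature.MathematicalPhysics.KineticTheory.HeatConduction.pinnedChain_exists_isSteadyState hω hl hβ hγ N h1 h2
    exact ⟨μ, hμ, fun ν hν => hUq N T_L T_R h1 h2 ν μ hν hμ⟩
  have hW := fun T (hT : 0 < T) => Theorems.AbelThermodynamicLimit.SeriesLawAtEveryLaplaceFrequency.stub_repairedCruxOfUniformAbelianRegularity hR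
      ω₂ lam β γ hω hl hβ hγ hUq T hT (by
    obtain ⟨μT, hG, hSI, hRefl, D, hP, hShift⟩ := hSet ω₂ lam β γ hω hl hβ T hT
    obtain ⟨hAC, hCc, hrest⟩ := hHC ω₂ lam β γ hω hl hβ T hT μT hG hSI hRefl D hP hShift
    set V : ℝ → ℝ := fun τ => 2 * ∫ s in Ioc (0:ℝ) τ, (τ - s) * D.currentCorrelation μT s with hV
    obtain ⟨hV0, hLap⟩ := hrest V hV
    obtain ⟨K, hK, hQ'⟩ := hQ ω₂ lam β γ hω hl hβ T hT μT hG hSI hRefl D hP hShift hAC hCc V hV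
    obtain ⟨B, τ₁, hC'⟩ := hCeil ω₂ lam β γ hω hl hβ T hT μT hG hSI hRefl D hP hShift hAC hCc V hV
    have hU' := hU ω₂ lam β γ hω hl hβ T hT μT hG hSI hRefl D hP hShift hAC hCc V hV
    have main : ∃ κ₀ : ℝ, 0 < κ₀ ∧ Tendsto (fun ν : ℝ => ∫ t in Ioi (0:ℝ), Real.exp (-(ν * t)) * D.currentCorrelation μT t)
        (𝓝[>] 0) (𝓝 κ₀) := by
      set A : ℝ → ℝ := fun ν => ∫ t in Ioi (0:ℝ), Real.exp (-(ν * t)) * D.currentCorrelation μT t with hAd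
      have hA : ∀ ν : ℝ, 0 < ν → A ν = ν ^ 2 / 2 * ∫ t in Ioi (0:ℝ), Real.exp (-(ν * t)) * V t := fun ν hν => (hLap ν hν).2.2
      have hint : ∀ ν : ℝ, 0 < ν → IntegrableOn (fun t => Real.exp (-(ν * t)) * V t) (Ioi 0) := fun ν hν => (hLap ν hν).2.1
      have iter : ∀ (n : ℕ) (t : ℝ), 0 ≤ t → (n : ℝ) * (V t - K) ≤ V ((n : ℝ) * t) := by
        intro n t ht
        induction n with
        | zero => simpa using hV0 0 le_rfl
        | succ n ih =>
          have h1 := hQ' ((n : ℝ) * t) t (by positivity) ht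
          push_cast
          rw [show ((n : ℝ) + 1) * t = (n : ℝ) * t + t by ring]
          nlinarith
      have hV0K : V 0 ≤ K := by have := hQ' 0 0 le_rfl le_rfl; simp at this; linarith
      have hup : ∀ t : ℝ, 0 < t → V t ≤ B * t + K := by
        intro t ht
        obtain ⟨n, hn⟩ := exists_nat_ge (max (τ₁ / t) 1)
        have hn1 : (1 : ℝ) ≤ n := (le_max_right _ _).trans hn
        have hnt : τ₁ ≤ (n : ℝ) * t := by
          have : τ₁ / t ≤ n := (le_max_left _ _).trans hn
          rwa [div_le_iff₀ ht] at this
        have h1 := iter n t ht.le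
        have h2 := hC' _ hnt
        have : (n : ℝ) * (V t - K) ≤ (n : ℝ) * (B * t) := by nlinarith
        have := le_of_mul_le_mul_left this (by linarith)
        linarith
      set g : ℝ → ℝ := fun t => (V t - K) / t with hg
      have hbdd : BddAbove (g '' Ioi 0) := by
        refine ⟨B, ?_⟩
        rintro _ ⟨t, ht, rfl⟩
        have ht' : (0 : ℝ) < t := ht
        show (V t - K) / t ≤ B
        rw [div_le_iff₀ ht']
        linarith [hup t ht']
      have hne : (g '' Ioi 0).Nonempty := ⟨g 1, 1, by norm_num, rfl⟩
      set L := sSup (g '' Ioi 0) with hL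
      have hgle : ∀ t : ℝ, 0 < t → g t ≤ L := fun t ht => le_csSup hbdd ⟨t, ht, rfl⟩
      have hVle : ∀ t : ℝ, 0 < t → V t ≤ L * t + K := by
        intro t ht
        have := hgle t ht
        simp only [hg] at this
        rw [div_le_iff₀ ht] at this
        linarith
      have hLpos : 0 < L := by
        obtain ⟨τ, hτ0, hτ⟩ := hU' (K + 1)
        have hτpos : 0 < τ := by
          rcases hτ0.lt_or_eq with h | h
          · exact h
          · exfalso; rw [← h] at hτ; linarith
        have h1 : 0 < g τ := div_pos (by linarith) hτpos
        exact h1.trans_le (hgle τ hτpos)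
      have hlow : ∀ ε : ℝ, 0 < ε → ε ≤ L → ∃ C₂ : ℝ, 0 ≤ C₂ ∧ ∀ t : ℝ, 0 < t → (L - ε) * t - C₂ ≤ V t := by
        intro ε hε hεL
        obtain ⟨_, ⟨t₀, ht₀, rfl⟩, hgt₀⟩ := exists_lt_of_lt_csSup hne (show L - ε < L by linarith)
        have ht₀' : (0 : ℝ) < t₀ := ht₀
        have hgt : L - ε < (V t₀ - K) / t₀ := hgt₀
        rw [lt_div_iff₀ ht₀'] at hgt
        refine ⟨(L - ε) * t₀ + K, by nlinarith, fun t ht => ?_⟩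
        rcases lt_or_ge t t₀ with hlt | hge
        · nlinarith [hV0 t ht.le]
        · set n := ⌊t / t₀⌋₊ with hn
          have hnle : (n : ℝ) * t₀ ≤ t := by
            have := Nat.floor_le (show 0 ≤ t / t₀ by positivity)
            rw [← hn] at this
            rwa [le_div_iff₀ ht₀'] at this
          have hlt' : t < (n : ℝ) * t₀ + t₀ := by
            have := Nat.lt_floor_add_one (t / t₀)
            rw [← hn, div_lt_iff₀ ht₀'] at this
            linarith
          have hr : 0 ≤ t - (n : ℝ) * t₀ := by linarith
          have h1 := hQ' ((n : ℝ) * t₀) (t - (n : ℝ) * t₀) (by positivity) hr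
          rw [show (n : ℝ) * t₀ + (t - (n : ℝ) * t₀) = t by ring] at h1
          have h2 := iter n t₀ ht₀'.le
          have h3 := hV0 _ hr
          have h4 : (n : ℝ) * ((L - ε) * t₀) ≤ (n : ℝ) * (V t₀ - K) :=
            mul_le_mul_of_nonneg_left hgt.le (Nat.cast_nonneg n)
          have h5 : (t - t₀) * (L - ε) ≤ (n : ℝ) * t₀ * (L - ε) :=
            mul_le_mul_of_nonneg_right (by linarith) (by linarith)
          nlinarith
      have hE0 : ∀ ν : ℝ, 0 < ν → IntegrableOn (fun t => Real.exp (-(ν * t))) (Ioi 0) ∧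
          ∫ t in Ioi (0:ℝ), Real.exp (-(ν * t)) = ν⁻¹ := fun ν hν => by
        refine ⟨by simpa only [neg_mul] using exp_neg_integrableOn_Ioi 0 hν, ?_⟩
        rw [show (fun t : ℝ => Real.exp (-(ν * t))) = fun t => Real.exp (-ν * t) from funext fun t => by rw [neg_mul],
          integral_exp_mul_Ioi (neg_lt_zero.mpr hν) 0, mul_zero, Real.exp_zero, neg_div, one_div, inv_neg, neg_neg]
      have hE1 : ∀ ν : ℝ, 0 < ν → IntegrableOn (fun t => Real.exp (-(ν * t)) * t) (Ioi 0) ∧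
          ∫ t in Ioi (0:ℝ), Real.exp (-(ν * t)) * t = (ν ^ 2)⁻¹ := fun ν hν => by
        have h := Real.integral_rpow_mul_exp_neg_mul_Ioi (a := 2) (r := ν) (by norm_num) hν
        rw [Real.Gamma_two, mul_one, Real.rpow_two, one_div, inv_pow] at h
        have hv : ∫ t in Ioi (0:ℝ), Real.exp (-(ν * t)) * t = (ν ^ 2)⁻¹ :=
          (setIntegral_congr_fun measurableSet_Ioi fun t _ => by
            rw [show (2:ℝ) - 1 = 1 by norm_num, Real.rpow_one, mul_comm]).trans h
        exact ⟨Integrable.of_integral_ne_zero (by rw [hv]; positivity), hv⟩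
      have key : ∀ ν : ℝ, 0 < ν → ∀ p q : ℝ, IntegrableOn (fun t => Real.exp (-(ν * t)) * (p * t + q)) (Ioi 0) ∧
          ∫ t in Ioi (0:ℝ), Real.exp (-(ν * t)) * (p * t + q) = p * (ν ^ 2)⁻¹ + q * ν⁻¹ := fun ν hν p q => by
        obtain ⟨hi0, hv0⟩ := hE0 ν hν
        obtain ⟨hi1, hv1⟩ := hE1 ν hν
        rw [show (fun t : ℝ => Real.exp (-(ν * t)) * (p * t + q)) =
            fun t => p * (Real.exp (-(ν * t)) * t) + q * Real.exp (-(ν * t)) from funext fun t => by ring]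
        exact ⟨(hi1.const_mul p).add (hi0.const_mul q), by
          rw [integral_add (hi1.const_mul p) (hi0.const_mul q), integral_const_mul, integral_const_mul, hv1, hv0]⟩
      have hAup : ∀ ν : ℝ, 0 < ν → A ν ≤ L / 2 + K / 2 * ν := by
        intro ν hν
        obtain ⟨iU, vU⟩ := key ν hν L K
        have cU := setIntegral_mono_on (hint ν hν) iU measurableSet_Ioi
          fun t ht => mul_le_mul_of_nonneg_left (hVle t ht) (Real.exp_pos (-(ν * t))).le
        rw [vU] at cU
        rw [hA ν hν, ← show ν ^ 2 / 2 * (L * (ν ^ 2)⁻¹ + K * ν⁻¹) = L / 2 + K / 2 * ν by field_simp]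
        exact mul_le_mul_of_nonneg_left cU (by positivity)
      have hAlow : ∀ ε : ℝ, 0 < ε → ε ≤ L → ∃ C₂ : ℝ, 0 ≤ C₂ ∧ ∀ ν : ℝ, 0 < ν → (L - ε) / 2 - C₂ / 2 * ν ≤ A ν := by
        intro ε hε hεL
        obtain ⟨C₂, hC₂, hlo⟩ := hlow ε hε hεL
        refine ⟨C₂, hC₂, fun ν hν => ?_⟩
        obtain ⟨iL, vL⟩ := key ν hν (L - ε) (-C₂)
        have cL := setIntegral_mono_on iL (hint ν hν) measurableSet_Ioi
          fun t ht => mul_le_mul_of_nonneg_left (by linarith [hlo t ht]) (Real.exp_pos (-(ν * t))).le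
        rw [vL] at cL
        rw [hA ν hν, ← show ν ^ 2 / 2 * ((L - ε) * (ν ^ 2)⁻¹ + -C₂ * ν⁻¹) = (L - ε) / 2 - C₂ / 2 * ν by field_simp; ring]
        exact mul_le_mul_of_nonneg_left cL (by positivity)
      refine ⟨L / 2, by positivity, ?_⟩
      have hpos : ∀ᶠ ν in 𝓝[>] (0:ℝ), 0 < ν := eventually_mem_nhdsWithin
      have hlin : ∀ c : ℝ, Tendsto (fun ν : ℝ => c / 2 * ν) (𝓝[>] 0) (𝓝 0) := fun c => by
        have h1 : Tendsto (fun ν : ℝ => c / 2 * ν) (𝓝[>] 0) (𝓝 (c / 2 * 0)) :=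
          ((continuous_const.mul continuous_id).tendsto 0).mono_left nhdsWithin_le_nhds
        rwa [mul_zero] at h1
      rw [_root_.tendsto_order]
      refine ⟨fun a ha => ?_, fun b hb => ?_⟩
      · obtain ⟨C₂, -, hlo⟩ := hAlow (min ((L - 2 * a) / 2) (L / 2)) (lt_min (by linarith) (by linarith))
          ((min_le_right _ _).trans (by linarith))
        have hm := min_le_left ((L - 2 * a) / 2) (L / 2)
        filter_upwards [hpos, (hlin C₂).eventually (gt_mem_nhds (show (0:ℝ) < (L - 2 * a) / 4 by linarith))]
          with ν hν hν2
        linarith [hlo ν hν]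
      · filter_upwards [hpos, (hlin K).eventually (gt_mem_nhds (show (0:ℝ) < b - L / 2 by linarith))] with ν hν hν2
        linarith [hAup ν hν]
    obtain ⟨κ₀, hκ₀, hAbel⟩ := main
    exact ⟨μT, D, (T ^ 2)⁻¹ * κ₀, hG, hSI, hP, hAC, mul_pos (by positivity) hκ₀, hAbel.const_mul _⟩)
  classical
  refine ⟨fun T => if hT : 0 < T then (hW T hT).choose_spec.choose_spec.choose else 1, fun T hT => ?_, fun μ hμ T hT => ?_⟩
  · simp only [dif_pos hT]; exact (hW T hT).choose_spec.choose_spec.choose_spec.1.2.2.2.1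
  · -- D_N: no bonds for N ≤ 1; the landed open-chain Green–Kubo identity for N ≥ 2
    have hD : ∀ N : ℕ, ∃ D : ℝ, Tendsto (fun δ : ℝ =>
        (Literature.MathematicalPhysics.KineticTheory.HeatConduction.pinnedChain ω₂ lam β γ).totalCurrent
          (μ N (T + δ / 2) (T - δ / 2)) / δ) (𝓝[≠] 0) (𝓝 D) := by
      intro N
      rcases lt_or_ge N 2 with hN | hN
      · refine ⟨0, ?_⟩
        have key : ∀ (P : Literature.MathematicalPhysics.KineticTheory.HeatConduction.OscillatorChain)
            (ν : Measure (Literature.MathematicalPhysics.KineticTheory.HeatConduction.PhaseSpace N)), P.totalCurrent ν = 0 := by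
          intro P ν
          show ∑ i : Fin N, ∫ x, P.bondCurrent N i x ∂ν = 0
          refine Finset.sum_eq_zero fun i _ => ?_
          have hj : ∀ x, P.bondCurrent N i x = 0 := fun x => by
            unfold Literature.MathematicalPhysics.KineticTheory.HeatConduction.OscillatorChain.bondCurrent
            refine Finset.sum_eq_zero fun j _ => ?_
            have hji : ¬ (j.val = i.val + 1) := by have := j.isLt; omega
            rw [if_neg hji]
          simp only [hj, integral_zero]
        simp only [key, zero_div]
        exact tendsto_const_nhds
      · obtain ⟨-, h2⟩ := Theorems.OddSectorIrreversibility.Corrector.openChainGreenKubo_holds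
          ω₂ lam β γ hω hl hβ hγ hUq μ hμ T hT N hN
        exact ⟨_, h2⟩
    refine ⟨fun N => (hD N).choose, fun N => (hD N).choose_spec, ?_⟩
    simp only [dif_pos hT]
    exact (hW T hT).choose_spec.choose_spec.choose_spec.2 μ hμ _ fun N => (hD N).choose_spec


end StrategistS2

end Summit.AtomisticToContinuum.FouriersLaw.Theses.CageBudgetFekete
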